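/-
Copyright (c) 2026 the pub-hodgecm-mathlib formalisation cell (harness21).  Prover seat hodgecm-mathlib-LH4-p13 (g10), req620 Track A «(D-RAM) FOUR-FRAME» squad
F0∕P3c∕LH4; the (β₂) road (R-36), β₂ WORDs #34∕#36 «THE MIX-HI WALL» (lead LH4-p13, second LH7-p09 (g3)): the exact-level digit and the product class of a MIX-band member
are read on ANY presentation (populated or not); helper lane on h413 = stmt-HodgeConjecture-24833 (count-neutral).  2026-09-05.
-/
import Summits.HodgeConjecture.HodgeConjecture.Theorems.F0P3cDyRamMixBandProductRead      -- ★ p864672 (this seat): the frame; brings the label law ★ p864323, the READ ★ p864505, ★ p864080, ★ FILE 10, ★ `…DepthFormLineModel`, ★ p864081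
import Summits.HodgeConjecture.HodgeConjecture.Theorems.F0P3cDyRamMixBandProductSocket    -- ★ p864637 (this seat): §1 `exactDigit_smul_iff`; brings ★ `…FaceTubeAbove` §3 `weight_smul_ne_zero_iff_weight_eq_zero_of_le`, ★ `…ConeCellFlipBalance`
import Summits.HodgeConjecture.HodgeConjecture.Theorems.F0P3cDyRamLowerMixHiProductRead    -- ★ p864303 (LH7-p09 (g3)): §1 `prodClass_smul_iff`
import HarnessLib

/-!
# Crux `H413`, line LH4 «(D-RAM) FOUR-FRAME» — STAGE-1b, row (2) of `f_{T₊}`, the (β₂) road (R-36), the MIX-HI WALL (β₂ WORDs #34∕#36): «THE EXACT-LEVEL DIGIT AND THE PRODUCT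
# CLASS ARE FUNCTIONS OF THE MEMBER» — for EVERY member `Λ` of a cone cell `(j, b)` with `d ≤ b` (populated OR NOT) and EVERY presentation `x₀` of it with glue unit `r₀` and ray
# scalar `e₀`: `NX Λ ⟺ |e₀| = |ϖ|^{ℓ₀}`, and for every `σ`-fixed unit `e′` with `|e₀ − e′t₊| ≤ |ϖ|^{m⋆}`: `Pc Λ ⟺ r₀·e′ ∈ N(E^×)`

Cell `hodgecm-mathlib` (D-0151), FLOOR 0, crux item H413 = `stmt-HodgeConjecture-24833`, route of record `HCCMUnconditional`; squads F0∕P3c∕LH4 ∕ LH7; lane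
`--supports stmt-HodgeConjecture-24833 --as helper` (count-neutral; pays NO tier-0 row).  THEOREMS ONLY (no `def`, no instance, no notation, no `sorry`, default heartbeats);
★-only imports; states NO law; ‹PRODBAL-U›∕‹PRODBAL-D›, the MIX-HI band letters and (β₂) stay HYPOTHESES.  Frame = ★ p864672 `reads_of_weight_ne_zero`'s VERBATIM, minus `c₀`,
plus `|2| < 1` and the exact flip unit `z` (`|z| = 1`, `z·Θz = jE ξ₀`, `ξ₀` a `σ`-fixed NON-norm) of ★ p864637 §2.

WHY (MIX-HI lead; digit payers of ‹PRODBAL-U∕D› = `#{Λ ∈ cell ∣ NX Λ ∧ Pc Λ} = #{Λ ∈ cell ∣ NX Λ ∧ ¬ Pc Λ}` (★ p864724∕p864725); LH7-p10 (g3) 02:49:00Z E-kernel: at a presentation `x₀`,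
`r₀·e′ = −⟨w₀,w₀⟩²·(ϖσϖ)^b·g∕h_W`, `g = e′∕⟨w₀,w₀⟩`, so `ω(r₀e′) = ω(−g∕h_W)` — an AFFINE sign of the digit by ★ p864387).  Both predicates of the letters are EXISTENTIAL over
presentations («SOME presentation `x₀` of `Λ` has …»); a digit payer enumerates the members through ONE frame per member (★ p864444 `exists_vertexFrame_of_gen`) and needs the
predicates read AT THAT frame, for populated AND unpopulated members.  THIS FILE proves the reads are presentation-free:
* HEAD `exactDigit_and_prodClass_of_presentation` — for `Λ ∈ levelSetDep(j, b; μ)` and ANY presentation `x₀` (order ∕ primitivity ∕ level clauses) with a `σ`-fixed unit `r₀`,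
  `jE r₀ = glueUnit(x₀, b)`, and a ray scalar `e₀` (`jE e₀ = Tr_ρ(μ∕(ϖE^j(α − ρα)·ΘY(x₀)))`):  (a) `NX Λ ↔ |e₀| = |ϖ|^{ℓ₀}`;  (b) for every `σ`-fixed unit `e′` with
  `|e₀ − e′·t₊| ≤ |ϖ|^{m⋆}`: `Pc Λ ↔ ∃ c, c·σc = r₀·e′`.
PROOF.  (←) in (a)(b) is the witness `x₀` itself.  (→), POPULATED member (`f b j Λ ≠ 0`): a glued vertex `L₃` exists (★ p864081); ★ `exists_glueLetters_of_gen` at `x₀` and at the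
witness presentation `x₁` give (★ p864080) «exact level ⟺ `|e| = |ϖ|^{ℓ₀}`» at both, whence (a); for (b) the witness's `r₁` is a norm (★ (C1)'s `hf` at `x₁`, populated, ★ Lit), so
its `e′₁` is, so `VS_{m⋆}(L₃) = V(X₊)` (label law ★ p864323 §3 on the shell ★ FILE 10 + ★ p864505 READ on the value `e₁`, ★ `valueSet_endoGL_sub_one_glued_eq_normFormSet_of_gen`),
and reading the SAME vertex on the value `e₀ ≈ e′t₊` (★ p864505 again) gives `e′ ∈ N`, while `r₀ ∈ N` by `hf` at `x₀`.  (→), UNPOPULATED member: `Λ′ := z⁻¹ • Λ` lies in the cell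
(★ `smul_mem_levelSetDep_iff_of_flip`) and is POPULATED (★ `weight_smul_ne_zero_iff_weight_eq_zero_of_le`: the exact ω-flip reverses populatedness at `d ≤ b`); `NX`, `Pc` are
flip-invariant (★ p864637 §1, ★ p864303 §1); `z⁻¹x₀` presents `Λ′` with glue unit `r₀ξ₀`, ray scalar `e₀ξ₀` and approximant `e′ξ₀` (★ `dualGen_mul_left`, ★ `glueUnit_mul_left`);
the populated case at `Λ′` gives `|e₀ξ₀| = |ϖ|^{ℓ₀}` resp. `r₀e′ξ₀² ∈ N`, and `|ξ₀| = 1`, `ξ₀² = ξ₀·σξ₀ ∈ N`.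
HONEST LABEL.  Count-neutral composition of ★ pieces; nothing printed is asserted; no census law is stated; ‹PRODBAL-U∕D∕L›, the MIX-HI band letters and (β₂) `stub_law_cleanSgn₂`
stay OPEN; `HC_CM` is proved only modulo the 7 printed citations (2 remaining named inputs: hLiu418 = `stmt-HodgeConjecture-24832`, h413 = `stmt-HodgeConjecture-24833`) until rung 0
closes.
## References
* [Rogawski1990] J. D. Rogawski, *Automorphic Representations of Unitary Groups in Three Variables*, Ann. of Math. Stud. 123 (1990): §4.9 Prop. 4.9.1 (b) p. 55.
* [Kottwitz1986BaseChangeUnits] R. E. Kottwitz, *Base change for unit elements of Hecke algebras*, Compositio Math. 60 (1986): §1 pp. 240–241; §3.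
* [Jacobowitz1962] R. Jacobowitz, *Hermitian forms over local fields*, Amer. J. Math. 84 (1962): §4 (duals, gluing, the glue unit).
* [Serre1979] J.-P. Serre, *Local Fields*, GTM 67 (1979): Ch. V §3 Prop. 5, Cor. 2–3 pp. 84–86 (norm classes of units: index two); Ch. III §6 Prop. 12.
* [LabesseLanglands1979] J.-P. Labesse, R. P. Langlands, *L-indistinguishability for SL(2)*, Canad. J. Math. 31 (1979): §2 p. 8.
-/

set_option autoImplicit false

noncomputable section

namespace Summit.HodgeConjecture.HodgeConjecture.Cruxes.H413.F0P3cDyRamMixBandProductClassOfMember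

open scoped Valued WithZero Matrix MatrixGroups Pointwise
open WithZero
open Literature.NumberTheory.Automorphic Literature.NumberTheory.Automorphic.HermitianLattice Literature.NumberTheory.Automorphic.UnitaryLatticeTree
open Literature.NumberTheory.Automorphic.UnitaryThreeFourFrame (IsRamifiedQuadraticDatum)
open Literature.NumberTheory.Automorphic.EllipticPlaneAsFieldLine
open Literature.NumberTheory.Rogawski1990
open Literature.NumberTheory.LocalFields (isAdicComplete_valuedInteger_of_completeSpace)
open Literature.NumberTheory.LocalFields.WildQuadraticDatum (natCard_normFibre_eq_zero_of_not_exists_of_le)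
open Summit.HodgeConjecture.HodgeConjecture.Cruxes.H413.F0P3cDyRamFourFramePieces
open Summit.HodgeConjecture.HodgeConjecture.Cruxes.H413.F0P3cDyRamFourFrameCensusDefs (LatticeInLevel LatticeNearTransvShell)
open Summit.HodgeConjecture.HodgeConjecture.Cruxes.H413.F0P3cDyRamStageOneBDefs (mcOfRecord mstarOfRecord_le_mcOfRecord)
open Summit.HodgeConjecture.HodgeConjecture.Cruxes.H413.F0P3cDyRamToricCensusDefs
open Summit.HodgeConjecture.HodgeConjecture.Cruxes.H413.F0P3cDyRamConeCellFaceAxis (valueSetMod_smul_xPlus_eq_plus_iff_exists_norm)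
open Summit.HodgeConjecture.HodgeConjecture.Cruxes.H413.F0P3cDyRamLabelShellFlipCardTwo (v_refSkew_eq)
open Summit.HodgeConjecture.HodgeConjecture.Cruxes.H413.F0P3cDyRamMixHiClassForm (exists_fixed_unit_valueSet_eq_smul_xPlus_of_shell_offBlock)
open Summit.HodgeConjecture.HodgeConjecture.Cruxes.H413.F0P3cDyRamCleanShellLabelRead (eq_plus_iff_exists_norm_of_value_near_fixed)
open Summit.HodgeConjecture.HodgeConjecture.Cruxes.H413.F0P3cDyRamUpperLineRayLetters (exactLevel_iff_v_rayScalar_eq)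
open Summit.HodgeConjecture.HodgeConjecture.Cruxes.H413.F0P3cDyRamShellOfExactLevel (latticeNearTransvShell_iff_exactLevel_of_prod)
open Summit.HodgeConjecture.HodgeConjecture.Cruxes.H413.F0P3cDyRamDepthFormLineModel (valueSet_endoGL_sub_one_glued_eq_normFormSet_of_gen)
open Summit.HodgeConjecture.HodgeConjecture.Cruxes.H413.F0P3cDyRamLowerLineFlipFace (exists_glueLetters_of_gen)
open Summit.HodgeConjecture.HodgeConjecture.Cruxes.H413.F0P3cDyRamConeCellGluedVertexExistsOfWeight (exists_glued_of_mem_levelSetDep_of_weight_ne_zero)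
open Summit.HodgeConjecture.HodgeConjecture.Cruxes.H413.F0P3cDyRamConeWeightHalfSplit (dualGen_mul_left isOrd_mul_left_iff_of_fixed_unit glueUnit_mul_left)
open Summit.HodgeConjecture.HodgeConjecture.Cruxes.H413.F0P3cDyRamConeCellFlipBalance (smul_mem_levelSetDep_iff_of_flip)
open Summit.HodgeConjecture.HodgeConjecture.Cruxes.H413.F0P3cDyRamConeCellFaceTubeAbove (weight_smul_ne_zero_iff_weight_eq_zero_of_le)
open Summit.HodgeConjecture.HodgeConjecture.Cruxes.H413.F0P3cDyRamMixBandProductSocket (exactDigit_smul_iff)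
open Summit.HodgeConjecture.HodgeConjecture.Cruxes.H413.F0P3cDyRamLowerMixHiProductRead (prodClass_smul_iff)

variable {E M : Type} [Field E] [Valued E ℤᵐ⁰] [Field M] [Valued M ℤᵐ⁰] {ρ Θ : M →+* M} {α : M}

/-- **HEAD — «THE EXACT-LEVEL DIGIT AND THE PRODUCT CLASS ARE FUNCTIONS OF THE MEMBER».**  Frame of ★ p864672 (junction frame, the literal's block `hlam2 hρlam (u) (P₁ hA hΓ)`, the
fence `hn hu1N hlam1`, the cell `hb1 hdb hlamj` with its four letters `hμl hlamρ hμk hprod`, ★ (C1)'s `hf`, the digit `NX` and the product class `Pc` with their defining `Iff`s)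
+ `|2| < 1` + the exact flip unit `z hz1 ξ₀ hzξ hσξ hξN`.  THEN for every member `Λ` of `levelSetDep(j, b; lam − jE u₀₀)` (populated or not), every presentation `x₀` of it, every
`σ`-fixed unit `r₀` with `jE r₀ = glueUnit(x₀, b)` and every ray scalar `e₀` on `x₀`:  `(NX Λ ↔ |e₀| = |ϖ|^{d % 2})` and, for every `σ`-fixed unit `e′` with `|e₀ − e′·t₊| ≤ |ϖ|^{m⋆}`,
`(Pc Λ ↔ ∃ c, c·σc = r₀·e′)`. [cite: Rogawski1990, §4.9 Prop. 4.9.1 (b) p. 55] [cite: Kottwitz1986BaseChangeUnits, §1 pp. 240–241; §3] [cite: Serre1979, Ch. V §3 Prop. 5, Cor. 2–3 pp. 84–86]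
[cite: Jacobowitz1962, §4] [cite: LabesseLanglands1979, §2 p. 8] -/
theorem exactDigit_and_prodClass_of_presentation [CompleteSpace E] [IsDiscreteValuationRing 𝒪[E]] [Finite 𝓀[E]]
    (σ : E →+* E) (hσ : ∀ a, σ (σ a) = a) (hvσ : ∀ a, Valued.v (σ a) = Valued.v a) {ϖ : E} (hϖ : Valued.v ϖ = exp (-1 : ℤ))
    {d t : ℕ} (hD : IsRamifiedQuadraticDatum σ ϖ d t) (h2 : ¬ IsUnit (2 : 𝒪[E])) (h2v : Valued.v (2 : E) < 1)
    {H₂ : Matrix (Fin 2) (Fin 2) E} (hH₂ : IsUnit H₂.det) (hH₂σ : (H₂.map σ)ᵀ = H₂) {hW : E} (hhW : Valued.v hW = 1) (hhWσ : σ hW = hW)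
    (jE : E →+* M) (hρρ : ∀ x, ρ (ρ x) = x) (hvρ : ∀ x, Valued.v (ρ x) = Valued.v x) (hα : ρ α ≠ α) (hα1 : Valued.v α ≤ 1)
    (hint : ∀ z : M, Valued.v z ≤ 1 → Valued.v ((z - ρ z) / (α - ρ α)) ≤ 1)
    (hΘΘ : ∀ x, Θ (Θ x) = x) (hΘρ : ∀ x, Θ (ρ x) = ρ (Θ x)) (hvΘ : ∀ x, Valued.v (Θ x) = Valued.v x) (hΘj : ∀ c, Θ (jE c) = jE (σ c))
    (hjv : ∀ c, Valued.v (jE c) ≤ 1 ↔ Valued.v c ≤ 1) (hjiso : ∀ c, Valued.v (jE c) = Valued.v c) (hjfix : ∀ z, ρ z = z ↔ ∃ c, jE c = z)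
    (hjpow : ∀ (t : E) (n : ℤ), Valued.v (jE t) = Valued.v (jE ϖ) ^ n ↔ Valued.v t = Valued.v ϖ ^ n)
    (hϖmax : ∀ t : M, ρ t = t → Valued.v t < 1 → Valued.v t ≤ Valued.v (jE ϖ))
    (φ : (Fin 2 → E) →+ M) (hφs : ∀ (c : E) (x : Fin 2 → E), φ (c • x) = jE c * φ x) (hφi : Function.Injective φ) (hφo : Function.Surjective φ)
    {γ₂ : GL (Fin 2) E} {lam h : M} (hφγ : ∀ x, φ ((γ₂ : Matrix (Fin 2) (Fin 2) E).mulVec x) = lam * φ x) (hlam : Valued.v lam = 1)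
    (hΘh : Θ h = h) (hh : h ≠ 0) (hform : ∀ x y, jE (pairing σ H₂ x y) = h * Θ (φ x) * φ y + ρ (h * Θ (φ x) * φ y))
    -- the literal `(γ₂, u)`: `lam`'s characteristic polynomial and the unitary embedding (★ p861305 §3's general block, for the label law ★ p864323 §3)
    (hlam2 : lam * lam = jE (γ₂ : Matrix (Fin 2) (Fin 2) E).trace * lam - jE (γ₂ : Matrix (Fin 2) (Fin 2) E).det)
    (hρlam : ρ lam = jE (γ₂ : Matrix (Fin 2) (Fin 2) E).trace - lam) (u : GL (Fin 1) E)
    (P₁ : GL (Fin 3) E) (hA : formCongr σ P₁ ((StdForm.antidiagonal 3).over E) = (!![H₂ 0 0, 0, H₂ 0 1; 0, hW, 0; H₂ 1 0, 0, H₂ 1 1] : Matrix (Fin 3) (Fin 3) E))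
    (hΓ : P₁ * endoGL (γ₂, u) * P₁⁻¹ ∈ unitaryGroupOfForm σ ((StdForm.antidiagonal 3).over E))
    -- the fence
    {n : ℕ} (hn : mcOfRecord d ≤ n) (hu1N : Valued.v (((u : Matrix (Fin 1) (Fin 1) E) 0 0) - 1) ≤ Valued.v (ϖ ^ n)) (hlam1 : Valued.v (lam - 1) ≤ Valued.v (jE ϖ ^ n))
    -- the cell and its four letters
    {b j : ℕ} (hb1 : 1 ≤ b) (hdb : d ≤ b) (hlamj : IsOrd ρ α (jE ϖ ^ j) lam)
    (hμl : Valued.v (lam - jE ((u : Matrix (Fin 1) (Fin 1) E) 0 0)) ≤ Valued.v (jE ϖ) ^ (d % 2 + 1 + b))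
    (hlamρ : Valued.v (lam - ρ lam) ≤ Valued.v (jE ϖ ^ j * (α - ρ α)) * Valued.v (jE ϖ) ^ (d % 2 + 1))
    (hμk : Valued.v (lam - jE ((u : Matrix (Fin 1) (Fin 1) E) 0 0)) ≤ Valued.v (jE ϖ) ^ (mcOfRecord d - d % 2))
    (hprod : Valued.v (lam - jE ((u : Matrix (Fin 1) (Fin 1) E) 0 0)) * Valued.v ((lam - jE ((u : Matrix (Fin 1) (Fin 1) E) 0 0)) - ρ (lam - jE ((u : Matrix (Fin 1) (Fin 1) E) 0 0))) ≤
      Valued.v (jE ϖ ^ j * (α - ρ α)) * Valued.v (jE ϖ) ^ b * Valued.v (jE ϖ) ^ mcOfRecord d)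
    -- ★ (C1)'s weight letter
    (f : ℕ → ℕ → AddSubgroup M → ℕ)
    (hf : ∀ (b j : ℕ) (Λ : AddSubgroup M) (x₀ : M) (r : E), 1 ≤ b → x₀ ≠ 0 →
      (∀ x, x ∈ Λ ↔ ∃ z, IsOrd ρ α (jE ϖ ^ j) z ∧ x = x₀ * z) →
      IsOrd ρ α (jE ϖ ^ j) (dualGen ρ Θ α (jE ϖ ^ j) h x₀) → ¬ IsOrd ρ α (jE ϖ ^ j) (dualGen ρ Θ α (jE ϖ ^ j) h x₀ / jE ϖ) →
      Valued.v (dualGen ρ Θ α (jE ϖ ^ j) h x₀) = Valued.v (jE ϖ) ^ b →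
      (∀ b', (∀ x ∈ Λ, Valued.v (h * Θ x * b' + ρ (h * Θ x * b')) ≤ 1) → (lam - jE ((u : Matrix (Fin 1) (Fin 1) E) 0 0)) * b' ∈ Λ) →
      IsOrd ρ α (jE ϖ ^ j) lam → jE r = glueUnit ρ Θ α (jE ϖ ^ j) h (jE ϖ) (jE hW) x₀ b →
      f b j Λ = Nat.card {x : 𝒪[E] ⧸ 𝓂[E] ^ (2 * b) // ∃ u' : 𝒪[E], Ideal.Quotient.mk (𝓂[E] ^ (2 * b)) u' = x ∧
        Valued.v ((u' : E) * σ u' - r) ≤ Valued.v (ϖ ^ (2 * b))})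
    -- the exact-level digit and the product class
    (NX : AddSubgroup M → Prop)
    (hNX : ∀ Λ, NX Λ ↔ ∃ (x₀ : M) (e₀ : E), x₀ ≠ 0 ∧ (∀ x, x ∈ Λ ↔ ∃ ζ, IsOrd ρ α (jE ϖ ^ j) ζ ∧ x = x₀ * ζ) ∧
      IsOrd ρ α (jE ϖ ^ j) (dualGen ρ Θ α (jE ϖ ^ j) h x₀) ∧ ¬ IsOrd ρ α (jE ϖ ^ j) (dualGen ρ Θ α (jE ϖ ^ j) h x₀ / jE ϖ) ∧
      Valued.v (dualGen ρ Θ α (jE ϖ ^ j) h x₀) = Valued.v (jE ϖ) ^ b ∧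
      jE e₀ = (lam - jE ((u : Matrix (Fin 1) (Fin 1) E) 0 0)) / (jE ϖ ^ j * (α - ρ α) * Θ (dualGen ρ Θ α (jE ϖ ^ j) h x₀)) +
        ρ ((lam - jE ((u : Matrix (Fin 1) (Fin 1) E) 0 0)) / (jE ϖ ^ j * (α - ρ α) * Θ (dualGen ρ Θ α (jE ϖ ^ j) h x₀))) ∧
      Valued.v e₀ = Valued.v ϖ ^ (d % 2))
    (Pc : AddSubgroup M → Prop)
    (hPc : ∀ Λ, Pc Λ ↔ ∃ (x₀ : M) (r e₀ e' : E), x₀ ≠ 0 ∧ (∀ x, x ∈ Λ ↔ ∃ ζ, IsOrd ρ α (jE ϖ ^ j) ζ ∧ x = x₀ * ζ) ∧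
      IsOrd ρ α (jE ϖ ^ j) (dualGen ρ Θ α (jE ϖ ^ j) h x₀) ∧ ¬ IsOrd ρ α (jE ϖ ^ j) (dualGen ρ Θ α (jE ϖ ^ j) h x₀ / jE ϖ) ∧
      Valued.v (dualGen ρ Θ α (jE ϖ ^ j) h x₀) = Valued.v (jE ϖ) ^ b ∧
      σ r = r ∧ Valued.v r = 1 ∧ jE r = glueUnit ρ Θ α (jE ϖ ^ j) h (jE ϖ) (jE hW) x₀ b ∧
      jE e₀ = (lam - jE ((u : Matrix (Fin 1) (Fin 1) E) 0 0)) / (jE ϖ ^ j * (α - ρ α) * Θ (dualGen ρ Θ α (jE ϖ ^ j) h x₀)) +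
        ρ ((lam - jE ((u : Matrix (Fin 1) (Fin 1) E) 0 0)) / (jE ϖ ^ j * (α - ρ α) * Θ (dualGen ρ Θ α (jE ϖ ^ j) h x₀))) ∧
      σ e' = e' ∧ Valued.v e' = 1 ∧ Valued.v (e₀ - e' * ((ϖ - σ ϖ) * ((ϖ * σ ϖ) ^ ((d - d % 2) / 2))⁻¹)) ≤ Valued.v ϖ ^ mstarOfRecord d ∧
      ∃ c : E, c * σ c = r * e')
    (z : M) (hz1 : Valued.v z = 1) (ξ₀ : E) (hzξ : z * Θ z = jE ξ₀) (hσξ : σ ξ₀ = ξ₀) (hξN : ¬ ∃ e : E, e * σ e = ξ₀) :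
    ∀ Λ ∈ levelSetDep ρ Θ α (jE ϖ) h j b (lam - jE ((u : Matrix (Fin 1) (Fin 1) E) 0 0)),
      ∀ (x₀ : M) (r₀ e₀ : E), x₀ ≠ 0 → (∀ x, x ∈ Λ ↔ ∃ ζ, IsOrd ρ α (jE ϖ ^ j) ζ ∧ x = x₀ * ζ) →
        IsOrd ρ α (jE ϖ ^ j) (dualGen ρ Θ α (jE ϖ ^ j) h x₀) → ¬ IsOrd ρ α (jE ϖ ^ j) (dualGen ρ Θ α (jE ϖ ^ j) h x₀ / jE ϖ) →
        Valued.v (dualGen ρ Θ α (jE ϖ ^ j) h x₀) = Valued.v (jE ϖ) ^ b →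
        σ r₀ = r₀ → Valued.v r₀ = 1 → jE r₀ = glueUnit ρ Θ α (jE ϖ ^ j) h (jE ϖ) (jE hW) x₀ b →
        jE e₀ = (lam - jE ((u : Matrix (Fin 1) (Fin 1) E) 0 0)) / (jE ϖ ^ j * (α - ρ α) * Θ (dualGen ρ Θ α (jE ϖ ^ j) h x₀)) +
          ρ ((lam - jE ((u : Matrix (Fin 1) (Fin 1) E) 0 0)) / (jE ϖ ^ j * (α - ρ α) * Θ (dualGen ρ Θ α (jE ϖ ^ j) h x₀))) →
        (NX Λ ↔ Valued.v e₀ = Valued.v ϖ ^ (d % 2)) ∧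
          ∀ e' : E, σ e' = e' → Valued.v e' = 1 →
            Valued.v (e₀ - e' * ((ϖ - σ ϖ) * ((ϖ * σ ϖ) ^ ((d - d % 2) / 2))⁻¹)) ≤ Valued.v ϖ ^ mstarOfRecord d →
            (Pc Λ ↔ ∃ c : E, c * σ c = r₀ * e') := by
  haveI := isAdicComplete_valuedInteger_of_completeSpace (K := E) hϖ
  have hd : Valued.v (ϖ - σ ϖ) = Valued.v ϖ ^ d := hD.2.2.2.2.1
  have hms : mstarOfRecord d = d % 2 + 2 * d - 1 := rfl
  have hmc : mcOfRecord d = 2 * ((mstarOfRecord d + d) / 2) := rfl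
  have hd1 : 1 ≤ d := hD.2.2.2.2.2.1
  have hvϖ0 : Valued.v ϖ ≠ 0 := by rw [hϖ]; exact exp_ne_zero
  have hϖ0 : ϖ ≠ 0 := fun h0 => hvϖ0 (by rw [h0, map_zero])
  have hϖlt : Valued.v ϖ < 1 := by rw [hϖ, ← exp_zero, exp_lt_exp]; norm_num
  have hϖle : Valued.v ϖ ≤ 1 := hϖlt.le
  have hjϖ0 : jE ϖ ≠ 0 := (map_ne_zero jE).2 hϖ0
  have hjϖle : Valued.v (jE ϖ) ≤ 1 := (hjv ϖ).2 hϖle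
  have hρϖ : ρ (jE ϖ) = jE ϖ := (hjfix _).2 ⟨ϖ, rfl⟩
  have hα0 : α - ρ α ≠ 0 := sub_ne_zero.2 (Ne.symm hα)
  have hc : ρ (jE ϖ ^ j) = jE ϖ ^ j := by rw [map_pow, hρϖ]
  have hc0 : jE ϖ ^ j ≠ 0 := pow_ne_zero j hjϖ0
  have hcc : jE ϖ ^ j * (α - ρ α) ≠ 0 := mul_ne_zero hc0 hα0
  set H : Matrix (Fin 3) (Fin 3) E := !![H₂ 0 0, 0, H₂ 0 1; 0, hW, 0; H₂ 1 0, 0, H₂ 1 1] with hHdef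
  set X : Matrix (Fin 3) (Fin 3) E := (((endoGL (γ₂, u) : GL (Fin 3) E) : Matrix (Fin 3) (Fin 3) E) - 1) with hXdef
  set tp : E := (ϖ - σ ϖ) * ((ϖ * σ ϖ) ^ ((d - d % 2) / 2))⁻¹ with htp
  have hvt : Valued.v tp = Valued.v ϖ ^ (d % 2) := v_refSkew_eq hvσ hϖ hd
  have htp0 : tp ≠ 0 := fun h0 => by rw [h0, map_zero] at hvt; exact pow_ne_zero _ hvϖ0 hvt.symm
  have hpm0 : (0 : ℤᵐ⁰) < Valued.v (ϖ ^ mstarOfRecord d) := by rw [map_pow]; exact pow_pos (zero_lt_iff.2 hvϖ0) _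
  have hmlt : Valued.v ϖ ^ mstarOfRecord d < Valued.v ϖ ^ (d % 2) :=
    pow_lt_pow_right_of_lt_one₀ (zero_lt_iff.2 hvϖ0) hϖlt (by rw [hms]; omega)
  -- the fence at the levels used below
  have hpowE : ∀ {k l : ℕ}, k ≤ l → Valued.v (ϖ ^ l) ≤ Valued.v (ϖ ^ k) := fun hkl => by
    rw [map_pow, map_pow]; exact pow_le_pow_right_of_le_one' hϖle hkl
  have hul : Valued.v ((u : Matrix (Fin 1) (Fin 1) E) 0 0 - 1) ≤ Valued.v (ϖ ^ (d % 2 + 1)) := hu1N.trans (hpowE (by rw [hmc, hms] at hn; omega))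
  have huk : Valued.v ((u : Matrix (Fin 1) (Fin 1) E) 0 0 - 1) ≤ Valued.v (ϖ ^ (mcOfRecord d - d % 2)) := hu1N.trans (hpowE (by omega))
  have hum : Valued.v ((u : Matrix (Fin 1) (Fin 1) E) 0 0 - 1) ≤ Valued.v (ϖ ^ mstarOfRecord d) :=
    hu1N.trans (hpowE ((mstarOfRecord_le_mcOfRecord d).trans hn))
  have hlam1' : Valued.v (lam - 1) ≤ Valued.v (jE ϖ) ^ (d % 2 + 1) :=
    hlam1.trans (by rw [map_pow]; exact pow_le_pow_right_of_le_one' hjϖle (by rw [hmc, hms] at hn; omega))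
  -- the form is integral on a self-dual lattice
  have hintL : ∀ L : Submodule 𝒪[E] (Fin 3 → E), IsSelfDualLattice σ ϖ H L → ∀ y ∈ L, Valued.v (pairing σ H y y) ≤ 1 :=
    fun L hL y hy => (mem_dualLatt σ H L y).1 (le_dualLatt_of_isVertexLattice hvσ hL hy) y hy
  have hξ1 : Valued.v ξ₀ = 1 := by rw [← hjiso, ← hzξ, Valuation.map_mul, hvΘ, hz1, mul_one]
  -- a ray scalar exists on every presentation (the trace is `ρ`-fixed)
  have hray : ∀ x₁ : M, ∃ e₁ : E, jE e₁ = (lam - jE ((u : Matrix (Fin 1) (Fin 1) E) 0 0)) / (jE ϖ ^ j * (α - ρ α) * Θ (dualGen ρ Θ α (jE ϖ ^ j) h x₁)) +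
      ρ ((lam - jE ((u : Matrix (Fin 1) (Fin 1) E) 0 0)) / (jE ϖ ^ j * (α - ρ α) * Θ (dualGen ρ Θ α (jE ϖ ^ j) h x₁))) := fun x₁ =>
    (hjfix _).1 (by rw [map_add, hρρ, add_comm])
  -- THE POPULATED CASE at an arbitrary presentation
  have key : ∀ Λ ∈ levelSetDep ρ Θ α (jE ϖ) h j b (lam - jE ((u : Matrix (Fin 1) (Fin 1) E) 0 0)), f b j Λ ≠ 0 →
      ∀ (x₀ : M) (r₀ e₀ : E), x₀ ≠ 0 → (∀ x, x ∈ Λ ↔ ∃ ζ, IsOrd ρ α (jE ϖ ^ j) ζ ∧ x = x₀ * ζ) →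
        IsOrd ρ α (jE ϖ ^ j) (dualGen ρ Θ α (jE ϖ ^ j) h x₀) → ¬ IsOrd ρ α (jE ϖ ^ j) (dualGen ρ Θ α (jE ϖ ^ j) h x₀ / jE ϖ) →
        Valued.v (dualGen ρ Θ α (jE ϖ ^ j) h x₀) = Valued.v (jE ϖ) ^ b →
        σ r₀ = r₀ → Valued.v r₀ = 1 → jE r₀ = glueUnit ρ Θ α (jE ϖ ^ j) h (jE ϖ) (jE hW) x₀ b →
        jE e₀ = (lam - jE ((u : Matrix (Fin 1) (Fin 1) E) 0 0)) / (jE ϖ ^ j * (α - ρ α) * Θ (dualGen ρ Θ α (jE ϖ ^ j) h x₀)) +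
          ρ ((lam - jE ((u : Matrix (Fin 1) (Fin 1) E) 0 0)) / (jE ϖ ^ j * (α - ρ α) * Θ (dualGen ρ Θ α (jE ϖ ^ j) h x₀))) →
        (NX Λ → Valued.v e₀ = Valued.v ϖ ^ (d % 2)) ∧
          ∀ e' : E, σ e' = e' → Valued.v e' = 1 →
            Valued.v (e₀ - e' * ((ϖ - σ ϖ) * ((ϖ * σ ϖ) ^ ((d - d % 2) / 2))⁻¹)) ≤ Valued.v ϖ ^ mstarOfRecord d →
            Pc Λ → ∃ c : E, c * σ c = r₀ * e' := by
    intro Λ hΛ hfne x₀ r₀ e₀ hx₀ hΛx hyO hyp hylev hσr₀ hr₀1 hr₀ he₀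
    -- (i)+(ii): for ANY glued `L₃` and ANY presentation `x₁` with ray scalar `e₁`: «exact level ⟺ |e₁| = |ϖ|^{ℓ₀}», «e₁ is a value mod ϖ^{m⋆}», «exact level ⟹ shell»
    have hframe : ∀ (B : Submodule 𝒪[E] (Fin 2 → E)) (L₃ : Submodule 𝒪[E] (Fin 3 → E)), B.toAddSubgroup.map φ = Λ → IsSelfDualLattice σ ϖ H L₃ →
        L₃ ⊓ LinearMap.ker ((LinearMap.proj (1 : Fin 3) : (Fin 3 → E) →ₗ[E] E).restrictScalars 𝒪[E]) =
          B.map ((Matrix.toLin' (!![1, 0; 0, 0; 0, 1] : Matrix (Fin 3) (Fin 2) E)).restrictScalars 𝒪[E]) →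
        (∀ c : E, (Pi.single 1 c : Fin 3 → E) ∈ L₃ ↔ Valued.v c ≤ Valued.v ϖ ^ b) →
        ∀ (x₁ : M) (e₁ : E), x₁ ≠ 0 → (∀ x, x ∈ Λ ↔ ∃ ζ, IsOrd ρ α (jE ϖ ^ j) ζ ∧ x = x₁ * ζ) →
        IsOrd ρ α (jE ϖ ^ j) (dualGen ρ Θ α (jE ϖ ^ j) h x₁) → ¬ IsOrd ρ α (jE ϖ ^ j) (dualGen ρ Θ α (jE ϖ ^ j) h x₁ / jE ϖ) →
        Valued.v (dualGen ρ Θ α (jE ϖ ^ j) h x₁) = Valued.v (jE ϖ) ^ b →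
        jE e₁ = (lam - jE ((u : Matrix (Fin 1) (Fin 1) E) 0 0)) / (jE ϖ ^ j * (α - ρ α) * Θ (dualGen ρ Θ α (jE ϖ ^ j) h x₁)) +
          ρ ((lam - jE ((u : Matrix (Fin 1) (Fin 1) E) 0 0)) / (jE ϖ ^ j * (α - ρ α) * Θ (dualGen ρ Θ α (jE ϖ ^ j) h x₁))) →
        ((LatticeInLevel ϖ (d % 2) X L₃ ∧ ¬ LatticeInLevel ϖ (d % 2 + 1) X L₃) ↔ Valued.v e₁ = Valued.v ϖ ^ (d % 2)) ∧
          (∃ y ∈ L₃, Valued.v ((ϖ ^ mstarOfRecord d)⁻¹ * (e₁ - pairing σ H y (X *ᵥ y))) ≤ 1) ∧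
          ((LatticeInLevel ϖ (d % 2) X L₃ ∧ ¬ LatticeInLevel ϖ (d % 2 + 1) X L₃) → LatticeNearTransvShell ϖ (d % 2) (mcOfRecord d) X L₃) := by
      intro B L₃ hBΛ hL hLB htube x₁ e₁ hx₁ hΛx₁ hyO₁ hyp₁ hylev₁ he₁
      have hY0 : dualGen ρ Θ α (jE ϖ ^ j) h x₁ ≠ 0 := fun h0 => by
        rw [h0, map_zero] at hylev₁; exact pow_ne_zero b ((Valuation.ne_zero_iff _).2 hjϖ0) hylev₁.symm
      obtain ⟨w₀, g₀, hw₀Y, hpr, hg₀, hg₀1, hprg⟩ := exists_glueLetters_of_gen σ hσ hvσ hϖ hH₂ hH₂σ hhW jE hρρ hvρ hα hα1 hint hΘΘ hΘρ hvΘ hjv hjfix hjpow hϖmax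
        φ hφs hφi hφo hφγ hlam hΘh hh hform ((u : Matrix (Fin 1) (Fin 1) E) 0 0) hb1 hlamj hx₁ hΛx₁ hyO₁ hyp₁ hylev₁ hΛ.2 hBΛ hL hLB htube
      refine ⟨?_, ?_, fun hex => ?_⟩
      · -- ★ p864080 at level `ℓ₀ + 1`
        have hμl' : Valued.v (lam - jE ((u : Matrix (Fin 1) (Fin 1) E) 0 0)) ≤ Valued.v (jE ϖ ^ (d % 2 + 1) * dualGen ρ Θ α (jE ϖ ^ j) h x₁) := by
          rw [Valuation.map_mul, Valuation.map_pow, hylev₁, ← pow_add]; exact hμl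
        exact exactLevel_iff_v_rayScalar_eq hρρ hvρ hΘΘ hΘρ hvΘ hϖ jE hjv hρϖ φ hφs hφi hφγ hΘh htube hpr hLB.symm hg₀ hg₀1 hprg hBΛ hc hcc hx₁ hY0 hΛx₁ hw₀Y u
          (d % 2) hul hlam1' hlamρ hμl' he₁
      · -- the ray scalar is the norm-form value at `ζ = 0`, `a = 1`
        have hmem : e₁ ∈ {z : E | ∃ y ∈ L₃, Valued.v ((ϖ ^ mstarOfRecord d)⁻¹ * (z - pairing σ H y (X *ᵥ y))) ≤ 1} := by
          rw [valueSet_endoGL_sub_one_glued_eq_normFormSet_of_gen σ hϖ H₂ hW jE hjv hΘΘ φ hφs hφγ hh hform hpr (hintL L₃ hL) hLB.symm hg₀ hg₀1 hprg u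
            (mstarOfRecord d) hum hcc hx₁ hBΛ hΛx₁ hw₀Y, Set.mem_setOf_eq]
          refine ⟨0, 1, ⟨by rw [map_zero]; exact zero_le, by rw [map_zero, sub_zero, map_zero]; exact zero_le⟩, by rw [map_one], ?_⟩
          have e : (dualGen ρ Θ α (jE ϖ ^ j) h x₁ * 0 + jE 1) * Θ (dualGen ρ Θ α (jE ϖ ^ j) h x₁ * 0 + jE 1) = 1 := by
            rw [mul_zero, zero_add, map_one, map_one, mul_one]
          rw [e, mul_one, ← he₁, sub_self, mul_zero, map_zero]; exact zero_le
        exact hmem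
      · exact (latticeNearTransvShell_iff_exactLevel_of_prod hvρ hϖ jE hjv hjfix φ hφs hφi hφγ htube hpr hLB.symm hg₀ hg₀1 hprg hBΛ hx₁ hΛx₁ hw₀Y hylev₁ u
          (d % 2) (mcOfRecord d - d % 2) (mcOfRecord d) (by have := mstarOfRecord_le_mcOfRecord d; rw [hms] at this; omega) huk hμk
          (by rw [hylev₁]; exact hprod)).2 hex
    -- a ray scalar exists on every presentation (the trace is `ρ`-fixed)
    obtain ⟨xc, hxc, hΛxc, hyOc, hypc, hylevc⟩ := hΛ.1
    obtain ⟨ec, hec⟩ := hray xc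
    have hLab : ∀ (B : Submodule 𝒪[E] (Fin 2 → E)) (L₃ : Submodule 𝒪[E] (Fin 3 → E)), B.toAddSubgroup.map φ = Λ → IsSelfDualLattice σ ϖ H L₃ →
        L₃ ⊓ LinearMap.ker ((LinearMap.proj (1 : Fin 3) : (Fin 3 → E) →ₗ[E] E).restrictScalars 𝒪[E]) =
          B.map ((Matrix.toLin' (!![1, 0; 0, 0; 0, 1] : Matrix (Fin 3) (Fin 2) E)).restrictScalars 𝒪[E]) →
        (∀ c : E, (Pi.single 1 c : Fin 3 → E) ∈ L₃ ↔ Valued.v c ≤ Valued.v ϖ ^ b) →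
        (LatticeInLevel ϖ (d % 2) X L₃ ∧ ¬ LatticeInLevel ϖ (d % 2 + 1) X L₃) →
        ∃ e₃ : E, σ e₃ = e₃ ∧ Valued.v e₃ = 1 ∧
          {z : E | ∃ y ∈ L₃, Valued.v ((ϖ ^ mstarOfRecord d)⁻¹ * (z - pairing σ H y (X *ᵥ y))) ≤ 1} = valueSetMod σ ϖ (mstarOfRecord d) (e₃ • xPlus σ ϖ d) := by
      intro B L₃ hBΛ hL hLB htube hex
      exact exists_fixed_unit_valueSet_eq_smul_xPlus_of_shell_offBlock σ ϖ d t hD h2 jE ρ lam hvρ hjiso γ₂ u hlam2 hρlam hn hu1N hlam1 H₂ hW hH₂σ hhWσ P₁ hA hΓ hL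
        ((hframe B L₃ hBΛ hL hLB htube xc ec hxc hΛxc hyOc hypc hylevc hec).2.2 hex)
    -- `V(X₊) → Pc`: the canonical datum is a norm (populated), and `e₀ ≡ t₊·aσa`
    -- populated ⇒ glued
    obtain ⟨B, hBΛ, L₃, hL, hLB, htube⟩ := exists_glued_of_mem_levelSetDep_of_weight_ne_zero σ hσ hvσ hϖ hH₂ hH₂σ hhW hhWσ jE hρρ hvρ hα hα1 hint hΘΘ hΘρ hvΘ hΘj hjv hjfix
      hjpow hϖmax φ hφs hφi hφo hφγ hlam hΘh hh hform ((u : Matrix (Fin 1) (Fin 1) E) 0 0) hb1 hlamj f hf hΛ hfne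
    -- `r₀` is a norm (populated at the presentation `x₀`)
    have hN₀ : ∃ e : E, e * σ e = r₀ := by
      by_contra hN
      exact hfne ((hf b j Λ x₀ r₀ hb1 hx₀ hΛx hyO hyp hylev hΛ.2 hlamj hr₀).trans (natCard_normFibre_eq_zero_of_not_exists_of_le hD hσr₀ hr₀1 hN hdb))
    obtain ⟨hEX₀, ⟨y₀, hy₀, hyv₀⟩, -⟩ := hframe B L₃ hBΛ hL hLB htube x₀ e₀ hx₀ hΛx hyO hyp hylev he₀
    refine ⟨fun hN => ?_, fun e' hσe' he'1 hclose hP => ?_⟩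
    · -- (a): the witness presentation reads the exact level of `L₃`, and so does `x₀`
      obtain ⟨x₁, e₁, hx₁, hΛx₁, hyO₁, hyp₁, hylev₁, he₁, he₁v⟩ := (hNX Λ).1 hN
      exact hEX₀.1 (((hframe B L₃ hBΛ hL hLB htube x₁ e₁ hx₁ hΛx₁ hyO₁ hyp₁ hylev₁ he₁).1).2 he₁v)
    · -- (b): the witness's `r₁` is a norm, hence its `e′₁`; the vertex is then `+`, and `e′` read on `e₀` is a norm
      obtain ⟨x₁, r₁, e₁, e₁', hx₁, hΛx₁, hyO₁, hyp₁, hylev₁, hσr₁, hr₁1, hr₁, he₁, hσe₁', he₁'1, hclose₁, c₁, hc₁⟩ := (hPc Λ).1 hP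
      have hN₁ : ∃ e : E, e * σ e = r₁ := by
        by_contra hN
        exact hfne ((hf b j Λ x₁ r₁ hb1 hx₁ hΛx₁ hyO₁ hyp₁ hylev₁ hΛ.2 hlamj hr₁).trans (natCard_normFibre_eq_zero_of_not_exists_of_le hD hσr₁ hr₁1 hN hdb))
      have hr₁0 : r₁ ≠ 0 := fun h0 => by rw [h0, map_zero] at hr₁1; exact zero_ne_one hr₁1
      have hNe₁' : ∃ w : E, w * σ w = e₁' := by
        obtain ⟨e, he⟩ := hN₁
        have he0 : e ≠ 0 := fun h0 => hr₁0 (by rw [← he, h0, zero_mul])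
        refine ⟨c₁ / e, ?_⟩
        rw [map_div₀, div_mul_div_comm, hc₁, he, mul_div_cancel_left₀ _ hr₁0]
      obtain ⟨hEX₁, ⟨y₁, hy₁, hyv₁⟩, -⟩ := hframe B L₃ hBΛ hL hLB htube x₁ e₁ hx₁ hΛx₁ hyO₁ hyp₁ hylev₁ he₁
      -- `|e₁| = |t₊|` (a unit approximant exists), so `L₃` is at exact level and the label law applies
      have he₁v : Valued.v e₁ = Valued.v ϖ ^ (d % 2) := by
        have hlt : Valued.v (e₁ - e₁' * tp) < Valued.v (e₁' * tp) := by
          rw [Valuation.map_mul, he₁'1, one_mul, hvt]; exact hclose₁.trans_lt hmlt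
        rw [show e₁ = e₁' * tp + (e₁ - e₁' * tp) by ring, Valuation.map_add_eq_of_lt_left _ hlt, Valuation.map_mul, he₁'1, one_mul, hvt]
      have hex : LatticeInLevel ϖ (d % 2) X L₃ ∧ ¬ LatticeInLevel ϖ (d % 2 + 1) X L₃ := hEX₁.2 he₁v
      obtain ⟨e₃, he₃σ, he₃1, hS⟩ := hLab B L₃ hBΛ hL hLB htube hex
      -- `|val y − e′t₊| ≤ |ϖ|^{m⋆}` at both presentations
      rw [Valuation.map_mul, map_inv₀, inv_mul_le_iff₀ hpm0, mul_one, map_pow] at hyv₀ hyv₁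
      have hclose₁' : Valued.v (pairing σ H y₁ (X *ᵥ y₁) - e₁' * tp) ≤ Valued.v ϖ ^ mstarOfRecord d := by
        rw [show pairing σ H y₁ (X *ᵥ y₁) - e₁' * tp = (e₁ - e₁' * tp) - (e₁ - pairing σ H y₁ (X *ᵥ y₁)) by ring]
        exact (Valuation.map_sub _ _ _).trans (max_le hclose₁ hyv₁)
      have hclose₀' : Valued.v (pairing σ H y₀ (X *ᵥ y₀) - e' * tp) ≤ Valued.v ϖ ^ mstarOfRecord d := by
        rw [show pairing σ H y₀ (X *ᵥ y₀) - e' * tp = (e₀ - e' * tp) - (e₀ - pairing σ H y₀ (X *ᵥ y₀)) by ring]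
        exact (Valuation.map_sub _ _ _).trans (max_le hclose hyv₀)
      have hVS := (eq_plus_iff_exists_norm_of_value_near_fixed (L := (L₃ : Set (Fin 3 → E))) (val := fun y => pairing σ H y (X *ᵥ y))
        hD he₃σ he₃1 hS hy₁ hσe₁' he₁'1 hclose₁').2 hNe₁'
      have hNe' := (eq_plus_iff_exists_norm_of_value_near_fixed (L := (L₃ : Set (Fin 3 → E))) (val := fun y => pairing σ H y (X *ᵥ y))
        hD he₃σ he₃1 hS hy₀ hσe' he'1 hclose₀').1 hVS
      obtain ⟨c₀, hc₀⟩ := hN₀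
      obtain ⟨w, hw⟩ := hNe'
      exact ⟨c₀ * w, by rw [map_mul, mul_mul_mul_comm, hc₀, hw]⟩
  -- the inverse flip `z⁻¹`: data and the transport of a presentation
  have hj1 : Valued.v (jE ξ₀) = 1 := by rw [hjiso, hξ1]
  have hj0 : jE ξ₀ ≠ 0 := fun h0 => by rw [h0, map_zero] at hj1; exact zero_ne_one hj1
  have hξ0 : ξ₀ ≠ 0 := fun h0 => hj0 (by rw [h0, map_zero])
  have hz0 : z ≠ 0 := fun h0 => hj0 (by rw [← hzξ, h0, zero_mul])
  have hzi : z⁻¹ * Θ z⁻¹ = jE ξ₀⁻¹ := by rw [map_inv₀, ← mul_inv, hzξ, map_inv₀]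
  have hσξi : σ ξ₀⁻¹ = ξ₀⁻¹ := by rw [map_inv₀, hσξ]
  have hξi1 : Valued.v ξ₀⁻¹ = 1 := by rw [map_inv₀, hξ1, inv_one]
  have hρji : ρ (jE ξ₀⁻¹) = jE ξ₀⁻¹ := (hjfix _).2 ⟨ξ₀⁻¹, rfl⟩
  have hji1 : Valued.v (jE ξ₀⁻¹) = 1 := by rw [hjiso, hξi1]
  have hji0 : jE ξ₀⁻¹ ≠ 0 := fun h0 => by rw [h0, map_zero] at hji1; exact zero_ne_one hji1
  have hΘji : Θ (jE ξ₀⁻¹) = jE ξ₀⁻¹ := by rw [hΘj, hσξi]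
  have hzi0 : z⁻¹ ≠ 0 := inv_ne_zero hz0
  intro Λ hΛ x₀ r₀ e₀ hx₀ hΛx hyO hyp hylev hσr₀ hr₀1 hr₀ he₀
  by_cases hfne : f b j Λ ≠ 0
  · -- populated: `key` directly; (←) is the witness `x₀`
    obtain ⟨hA, hB⟩ := key Λ hΛ hfne x₀ r₀ e₀ hx₀ hΛx hyO hyp hylev hσr₀ hr₀1 hr₀ he₀
    exact ⟨⟨hA, fun hv => (hNX Λ).2 ⟨x₀, e₀, hx₀, hΛx, hyO, hyp, hylev, he₀, hv⟩⟩, fun e' hσe' he'1 hclose =>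
      ⟨hB e' hσe' he'1 hclose, fun ⟨c, hc⟩ => (hPc Λ).2 ⟨x₀, r₀, e₀, e', hx₀, hΛx, hyO, hyp, hylev, hσr₀, hr₀1, hr₀, he₀, hσe', he'1, hclose, c, hc⟩⟩⟩
  · -- unpopulated: flip to the populated member `Λ′ = z⁻¹ • Λ` presented by `z⁻¹x₀`
    rw [not_ne_iff] at hfne
    set Λ' : AddSubgroup M := z⁻¹ • Λ with hΛ'def
    have hzΛ' : z • Λ' = Λ := by rw [hΛ'def, smul_smul, mul_inv_cancel₀ hz0, one_smul]
    have hΛ' : Λ' ∈ levelSetDep ρ Θ α (jE ϖ) h j b (lam - jE ((u : Matrix (Fin 1) (Fin 1) E) 0 0)) :=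
      (smul_mem_levelSetDep_iff_of_flip hzi hρji hji1 (jE ϖ) h j b _ Λ).2 hΛ
    have hfne' : f b j Λ' ≠ 0 := by
      intro h0
      have hrev := weight_smul_ne_zero_iff_weight_eq_zero_of_le σ hσ hvσ hϖ hD h2v hH₂σ hhW hhWσ jE hρρ hvρ hα hα1 hint hΘΘ hΘρ hvΘ hΘj hjv hjfix hjpow hϖmax
        φ hφs hφi hφo hφγ hlam hΘh hh hform z hz1 ξ₀ hzξ hσξ hξN ((u : Matrix (Fin 1) (Fin 1) E) 0 0) hb1 hdb hlamj f hf hΛ'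
      rw [hzΛ'] at hrev
      exact (hrev.2 h0) hfne
    -- the transported presentation
    have hY0 : dualGen ρ Θ α (jE ϖ ^ j) h x₀ ≠ 0 := fun h0 => by
      rw [h0, map_zero] at hylev; exact pow_ne_zero b ((Valuation.ne_zero_iff _).2 hjϖ0) hylev.symm
    have hY : dualGen ρ Θ α (jE ϖ ^ j) h (z⁻¹ * x₀) = jE ξ₀⁻¹ * dualGen ρ Θ α (jE ϖ ^ j) h x₀ := dualGen_mul_left hzi (jE ϖ ^ j) h x₀
    have hx₀' : z⁻¹ * x₀ ≠ 0 := mul_ne_zero hzi0 hx₀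
    have hΛx' : ∀ x, x ∈ Λ' ↔ ∃ ζ, IsOrd ρ α (jE ϖ ^ j) ζ ∧ x = z⁻¹ * x₀ * ζ := fun x => by
      rw [hΛ'def, AddSubgroup.mem_smul_pointwise_iff_exists]
      constructor
      · rintro ⟨y, hy, rfl⟩
        obtain ⟨ζ, hζ, rfl⟩ := (hΛx y).1 hy
        exact ⟨ζ, hζ, by rw [smul_eq_mul, mul_assoc]⟩
      · rintro ⟨ζ, hζ, rfl⟩
        exact ⟨x₀ * ζ, (hΛx _).2 ⟨ζ, hζ, rfl⟩, by rw [smul_eq_mul, mul_assoc]⟩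
    have hyO' : IsOrd ρ α (jE ϖ ^ j) (dualGen ρ Θ α (jE ϖ ^ j) h (z⁻¹ * x₀)) := by
      rw [hY]; exact (isOrd_mul_left_iff_of_fixed_unit hρji hji1 (jE ϖ ^ j) _).2 hyO
    have hyp' : ¬ IsOrd ρ α (jE ϖ ^ j) (dualGen ρ Θ α (jE ϖ ^ j) h (z⁻¹ * x₀) / jE ϖ) := by
      rw [hY, mul_div_assoc, isOrd_mul_left_iff_of_fixed_unit hρji hji1 (jE ϖ ^ j)]; exact hyp
    have hylev' : Valued.v (dualGen ρ Θ α (jE ϖ ^ j) h (z⁻¹ * x₀)) = Valued.v (jE ϖ) ^ b := by rw [hY, Valuation.map_mul, hji1, one_mul, hylev]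
    have hσr₀' : σ (r₀ * ξ₀) = r₀ * ξ₀ := by rw [map_mul, hσr₀, hσξ]
    have hr₀1' : Valued.v (r₀ * ξ₀) = 1 := by rw [Valuation.map_mul, hr₀1, hξ1, mul_one]
    have hr₀' : jE (r₀ * ξ₀) = glueUnit ρ Θ α (jE ϖ ^ j) h (jE ϖ) (jE hW) (z⁻¹ * x₀) b := by
      rw [glueUnit_mul_left hΘΘ hzi hρji hji0 hY0 (jE ϖ) (jE hW) b, ← hr₀, map_mul, map_inv₀, div_inv_eq_mul]
    have he₀' : jE (e₀ * ξ₀) = (lam - jE ((u : Matrix (Fin 1) (Fin 1) E) 0 0)) / (jE ϖ ^ j * (α - ρ α) * Θ (dualGen ρ Θ α (jE ϖ ^ j) h (z⁻¹ * x₀))) +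
        ρ ((lam - jE ((u : Matrix (Fin 1) (Fin 1) E) 0 0)) / (jE ϖ ^ j * (α - ρ α) * Θ (dualGen ρ Θ α (jE ϖ ^ j) h (z⁻¹ * x₀)))) := by
      rw [map_mul, he₀, hY, map_mul Θ, hΘji,
        show (lam - jE ((u : Matrix (Fin 1) (Fin 1) E) 0 0)) / (jE ϖ ^ j * (α - ρ α) * (jE ξ₀⁻¹ * Θ (dualGen ρ Θ α (jE ϖ ^ j) h x₀))) =
          (lam - jE ((u : Matrix (Fin 1) (Fin 1) E) 0 0)) / (jE ϖ ^ j * (α - ρ α) * Θ (dualGen ρ Θ α (jE ϖ ^ j) h x₀)) * jE ξ₀ by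
            rw [map_inv₀]; field_simp,
        map_mul ρ, (hjfix _).2 ⟨ξ₀, rfl⟩, add_mul]
    obtain ⟨hA', hB'⟩ := key Λ' hΛ' hfne' (z⁻¹ * x₀) (r₀ * ξ₀) (e₀ * ξ₀) hx₀' hΛx' hyO' hyp' hylev' hσr₀' hr₀1' hr₀' he₀'
    refine ⟨⟨fun hN => ?_, fun hv => (hNX Λ).2 ⟨x₀, e₀, hx₀, hΛx, hyO, hyp, hylev, he₀, hv⟩⟩, fun e' hσe' he'1 hclose => ⟨fun hP => ?_, fun ⟨c, hc⟩ =>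
      (hPc Λ).2 ⟨x₀, r₀, e₀, e', hx₀, hΛx, hyO, hyp, hylev, hσr₀, hr₀1, hr₀, he₀, hσe', he'1, hclose, c, hc⟩⟩⟩
    · -- (a) →: `NX` passes to `Λ′`, the populated case reads `|e₀ξ₀| = |t₊|`
      have hN' : NX Λ' := (exactDigit_smul_iff jE hjiso hjfix hΘj h j b (d % 2) (lam - jE ((u : Matrix (Fin 1) (Fin 1) E) 0 0)) NX hNX hzξ hσξ hξ1 Λ').1
        (by rw [hzΛ']; exact hN)
      have hv := hA' hN'
      rwa [Valuation.map_mul, hξ1, mul_one] at hv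
    · -- (b) →: `Pc` passes to `Λ′`, the populated case gives `r₀ξ₀·e′ξ₀ ∈ N`, and `ξ₀²` is a norm
      have hP' : Pc Λ' := (prodClass_smul_iff hϖ jE hjiso hjfix hΘj hΘΘ h hW j b d (lam - jE ((u : Matrix (Fin 1) (Fin 1) E) 0 0)) Pc hPc hzξ hσξ hξ1 Λ').1
        (by rw [hzΛ']; exact hP)
      have hclose' : Valued.v (e₀ * ξ₀ - e' * ξ₀ * ((ϖ - σ ϖ) * ((ϖ * σ ϖ) ^ ((d - d % 2) / 2))⁻¹)) ≤ Valued.v ϖ ^ mstarOfRecord d := by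
        rw [show e₀ * ξ₀ - e' * ξ₀ * ((ϖ - σ ϖ) * ((ϖ * σ ϖ) ^ ((d - d % 2) / 2))⁻¹) =
            (e₀ - e' * ((ϖ - σ ϖ) * ((ϖ * σ ϖ) ^ ((d - d % 2) / 2))⁻¹)) * ξ₀ by ring, Valuation.map_mul, hξ1, mul_one]
        exact hclose
      obtain ⟨c', hc'⟩ := hB' (e' * ξ₀) (by rw [map_mul, hσe', hσξ]) (by rw [Valuation.map_mul, he'1, hξ1, mul_one]) hclose' hP'
      refine ⟨c' / ξ₀, ?_⟩
      rw [map_div₀, hσξ, div_mul_div_comm, hc', div_eq_iff (mul_ne_zero hξ0 hξ0)]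
      ring

end Summit.HodgeConjecture.HodgeConjecture.Cruxes.H413.F0P3cDyRamMixBandProductClassOfMember

end
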